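import Literature.AlgebraicGeometry.Milne1999.LefschetzCentraliserPowers
import Literature.AlgebraicGeometry.Milne1999.CentraliserFixesDivisorClasses
import HarnessLib

/-!
# Milne 1999, Theorem 4.4 read on `H¹`: `{g₁ | g ∈ ker l(A)(ℂ)} = S(A)(ℂ)` — the record discharged

Family `hodge`, layer `Literature/AlgebraicGeometry/Milne1999`, namespace
`Literature.AlgebraicGeometry.Milne1999` (D-0022). Written for the cell `pub-hodgecm2` (COR-CM, Hodge
ladder stage 2), seat `lit-milne`, binder table `HOME/lit/milne.md` row M4. This file DISCHARGES the cited
record `Milne1999_thm44_specialLefschetzGroup_one_eq_unitaryCentralizerGroup` of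
`Milne1999/LefschetzCentraliser` (D-0014/D-0026: the record stays a `def`, its users are fed
`Milne1999_thm44_specialLefschetzGroup_one_eq_unitaryCentralizerGroup_holds`; no new named fact, the four
`def`s below are constructions with bodies). It assembles four PROVED pieces of the tree:

* `⊆` — `specialLefschetzGroup_map_one_le_unitaryCentralizerGroup` (`LefschetzGroupCentraliserInclusion`);
* `⊇`, first power — `exteriorPullback_eq_self_of_mem_divisorClassesSpan_of_nondegenerate`
  (`CentraliserFixesDivisorClasses`: `S(A)(h)` fixes the divisor classes of `A`, for `h ∈ B¹(A) ⊗ ℂ` with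
  `Q_h` non-degenerate);
* `⊇`, powers — `diagPow_mem_unitaryCentralizerGroup` (`LefschetzCentraliserPowers`: the diagonal
  `u^{⊕(a+1)} ∈ S(A^{a+1})(Σᵢ prᵢ^* h)`, Milne §1 p. 643 "`C(A)` with `C(A^r)` as `k`-algebras with
  involution");
* the block form of `Q_D` on a product (`LefschetzGroupProducts`, `Motives/PolarizationPairingProduct`).

## Source read (held text `paper:doi-10-1215-s0012-7094-99-09620-5` = J. S. Milne, *Lefschetz classes on abelian varieties*, Duke Math. J. 96 (1999) 639–675), verbatim

* §4, p. 659 [p0021 L5–L9]: "**Definition 4.3.** The Lefschetz group `L(A)` of an abelian variety `A`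
  over `Ω` is the largest algebraic subgroup of `GL(V(A)) × 𝔾_m/k` fixing the elements of
  `D^s_hom(A^r)_k ⊂ H^{2s}(A^r)(s)` for all `r, s`."
* §4, p. 659 [p0021 L14–L20]: "**Theorem 4.4.** The map `γ ↦ (γ, γ†γ) : G(A) → GL(V(A)) × 𝔾_m` sends
  `G(A)` isomorphically onto `L(A)`. Proof. For any `γ ∈ G(A)(k)` and divisor `D` on `A`,
  `e_D(γx, γy) = e_D(x, γ†γx) = γ†γ · e_D(x, y)`, all `x, y ∈ V(A)`, and so `(γ, γ†γ)` fixes `e_D`. It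
  therefore fixes the class of `D` in `H²(A)(1)`. More generally, any `γ ∈ G(A)(k^al)` will fix all
  divisor classes on `A^r`, all `r`. This shows that `G(A) ⊂ L(A)`. For the converse, note that Theorem 3.2
  implies that `H^{2*}(A^r)(*)^{G(A)} = D_hom(A^r)_k` for all `r`, and so a variant of Chevalley's theorem
  (Deligne 1982, 3.1) implies that `L(A) = G(A)`."
* §4, p. 659 [p0021 L28–L30]: "The projection map `GL(V(A)) × 𝔾_m → 𝔾_m` defines a cocharacter of
  `L(A)`, which we denote `l(A)` (or just `l`). The theorem shows that the kernel of `l(A)`, regarded as a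
  subgroup of `GL(V(A))`, equals `S(A)`."
* §1, p. 643 [p0005 L12–L16]: "For any positive integer `r`, `V(A^r) = rV(A)`, and the diagonal action of
  `C(A)` on `rV(A)` identifies `C(A)` with `C(A^r)` (as `k`-algebras with involution). […] Moreover, if
  `Dᵢ` is an ample divisor on `Aᵢ`, `i = 1, …, s`, then `D = Σᵢ A₁ × ⋯ × A_{i-1} × Dᵢ × A_{i+1} × ⋯ × A_s`
  is an ample divisor on `A`, and the involution it defines on `C(A)` is the restriction of the product
  of the involutions on the `C(Aᵢ)` defined by the `Dᵢ`."

## What is proved (the tree's carriers: `ℂ`-points, Betti cohomology with complex coefficients)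

* **`Milne1999_thm44_specialLefschetzGroup_one_eq_unitaryCentralizerGroup_holds`** — for every complex
  abelian variety `A` and every polarization class `h` (rational, `s · h` Kähler for a real `s > 0`):
  `{g₁ | g ∈ specialLefschetzGroup (dim A) A.X} = unitaryCentralizerGroup A h`, i.e. "the kernel of
  `l(A)`, regarded as a subgroup of `GL(V(A))`, equals `S(A)`" on `ℂ`-points; the `def` of
  `Milne1999/LefschetzCentraliser` is now a theorem, and its consumers there
  (`…_of_thm44`) are restated unconditionally (`unitaryCentralizerGroup_eq_of_isKaehlerClass`,
  `hodgeGroupOne_eq_unitaryCentralizerGroup_of_hodgeGroup_eq`,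
  `hodgeGroupOne_eq_unitaryCentralizerGroup_of_forall_isDivisorGenerated'`).
* `unitaryCentralizerGroup_le_specialLefschetzGroup_map_one` — the `⊇` half: `u ∈ S(A)(ℂ)` is `g₁` for
  `g = (⋀ᵏu)_k`, whose Künneth family `⋀•(u^{⊕(a+1)})` (`exteriorKunnethFamily`,
  `isKunnethFamily_exteriorKunnethFamily`) fixes every Lefschetz class of every power
  (`exteriorKunnethFamily_apply_eq_self_of_mem_lefschetzPowClasses`).
* The inputs, each proved here: `exteriorPullbackEquiv` (`⋀ᵏu` as an automorphism, `⋀¹u = u`);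
  the Künneth step `⋀ᵏ(s ⊕ t)(pr_B^* x ∪ pr_C^* y) = pr_B^*(⋀ⁱs x) ∪ pr_C^*(⋀ʲt y)`
  (`exteriorPullback_prodBlockDiagEquiv_cross`); for the product class `pr_B^* h_B + pr_C^* h_C`:
  membership in `B¹ ⊗ ℂ`, non-vanishing of the top power
  (`lefschetzPow_prodPolarizationClass_self_ne_zero`, binomial theorem) and NON-DEGENERACY of `Q_D`
  from the factors (`eq_zero_of_forall_polarizationPairingOne_prod_eq_zero`, block form of `Q_D`); the
  same on all powers `A^{a+1}` by induction; and the transport of families of automorphisms along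
  `(A^{a+1}).X = A.X^{×(a+1)}` (`castAut`, `subst`).

## The proof of `⊇` (Milne's two sentences, on the carriers)

Milne: "`(γ, γ†γ)` fixes `e_D` […] therefore fixes the class of `D` […] any `γ ∈ G(A)(k^al)` will fix all
divisor classes on `A^r`, all `r`." On the carriers, for `u ∈ S(A)(ℂ)` (`γ†γ = 1`): (1) the diagonal
`u^{⊕(a+1)}` lies in `S(A^{a+1})(ℂ)` for Milne's product divisor `D^{(a+1)} = Σᵢ prᵢ^* D` (§1 p. 643;
`LefschetzCentraliserPowers`); (2) the class `h^{(a+1)} = Σᵢ prᵢ^* h` of `D^{(a+1)}` lies in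
`B¹(A^{a+1}) ⊗ ℂ`, has `(h^{(a+1)})^{dim} ≠ 0` and a NON-DEGENERATE pairing `Q_{h^{(a+1)}}` on `H¹(A^{a+1})`
(blockwise from `A^{a+2} = A^{a+1} × A`: the diagonal blocks of `Q` are non-zero multiples of
`Q_{h^{(a+1)}} ⊠ h^{dim A}` and `(h^{(a+1)})^{dim} ⊠ Q_h`, the mixed blocks vanish) — this replaces the
ampleness of `D^{(a+1)}`, for which the tree has no Kähler class on a product; (3) hence
(`CentraliserFixesDivisorClasses` ON `A^{a+1}`) `⋀•(u^{⊕(a+1)})` fixes `D^p_hom(A^{a+1})_ℂ` for all `p`;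
(4) `(⋀•(u^{⊕(a+1)}))_a` is a Künneth family with first member `(⋀ᵏu)_k` (multiplicativity of `⋀•` and
naturality along the projections), so `(⋀ᵏu)_k ∈ specialLefschetzGroup (dim A) A.X` and its degree-one
component is `⋀¹u = u`.

## What is NOT here

* Milne's algebraic groups over `k` and arbitrary Weil cohomologies (only `ℂ`-points and complex Betti
  cohomology); the similitude version `G(A) ≅ L(A)` with multiplier (`γ†γ ≠ 1`, Tate twists) — only
  `ker l(A) = S(A)`, which is what the record states; Cor. 4.5 (`H^{2*}(A^r)(*)^{L(A)} = D_hom(A^r)_k`,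
  Thm. 3.2's invariant theory: the separate record `Milne1999_specialLefschetzGroup_invariants_le`).

## References

* [Milne1999LefschetzClasses] J. S. Milne, Lefschetz classes on abelian varieties, Duke Math. J. 96
  (1999) 639–675: §1 pp. 643–644, §4 Def. 4.3, Thm. 4.4 with proof, p. 659 (`ker l(A) = S(A)`).
* [Deligne1982HodgeCycles] P. Deligne, Hodge cycles on abelian varieties, LNM 900 (1982), I §3, I §5
  (used inside `CentraliserFixesDivisorClasses`).
* [LangeBirkenhake1992] Ch. Birkenhake, H. Lange, Complex Abelian Varieties (1992), Lemma 1.1.17, §5.3.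
* [HatcherAT2002] A. Hatcher, Algebraic Topology (2002), §3.2 Prop. 3.10, Example 3.16, Thm. 3.16.
* [VoisinHodgeI2002] C. Voisin, Hodge Theory and Complex Algebraic Geometry I, §3.1.3 Cor. 3.9, Thm. 6.25,
  §7.1.2, §7.3.2.
* [vanGeemen1994HodgeAV] B. van Geemen, LNM 1594 (1994), 2.1 (`Bᵖ ⊗ ℂ`).
-/

noncomputable section

open CategoryTheory MonoidalCategory CartesianMonoidalCategory
open Literature.AlgebraicTopology.SingularHomology
open Literature.AlgebraicGeometry.HodgeTheory
open Literature.AlgebraicGeometry.Motives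
open Literature.AlgebraicGeometry.VanGeemen1994 (pullbackOne hodgeGroupOne mem_hodgeGroupOne_iff hodgeClassSpan)
open Literature.Barriers.HodgeConjecture (divisorClassesSpan divisorMonomials)
open Literature.Geometry.Kaehler (lefschetzPow lefschetzOperator lefschetzPow_succ lefschetzPow_zero
  lefschetzOperator_apply HasHardLefschetzProperty)

namespace Literature.AlgebraicGeometry.Milne1999

/-! ### §1 The exterior family `(⋀ᵏu)_k` of an automorphism `u` of `H¹` -/

section Exterior

universe u v

variable {R : Type v} [CommRing R] [Invertible (2 : R)] {X Y Z : Type u} [TopologicalSpace X]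
  [TopologicalSpace Y] [TopologicalSpace Z]

/-- `⋀•(L' ∘ L) = ⋀•L' ∘ ⋀•L` (both agree on products of degree-one classes). [cite: HatcherAT2002, §3.2 Example 3.16] -/
theorem exteriorPullback_comp (hX : HasExteriorCohomologyH1 R X) (hY : HasExteriorCohomologyH1 R Y)
    (L : singularCohomology R R X 1 →ₗ[R] singularCohomology R R Y 1)
    (L' : singularCohomology R R Y 1 →ₗ[R] singularCohomology R R Z 1) (d : ℕ) :
    exteriorPullback hX (L'.comp L) d = (exteriorPullback hY L' d).comp (exteriorPullback hX L d) := by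
  refine exteriorPullback_ext hX fun v ↦ ?_
  rw [exteriorPullback_cupPowOne, LinearMap.comp_apply, exteriorPullback_cupPowOne, exteriorPullback_cupPowOne]
  rfl

/-- `⋀•(id) = id`. [cite: HatcherAT2002, §3.2 Example 3.16] -/
theorem exteriorPullback_id (hX : HasExteriorCohomologyH1 R X) (d : ℕ) :
    exteriorPullback hX (LinearMap.id : singularCohomology R R X 1 →ₗ[R] singularCohomology R R X 1) d =
      LinearMap.id := by
  refine exteriorPullback_ext hX fun v ↦ ?_
  rw [exteriorPullback_cupPowOne]
  rfl

/-- **The exterior family of an automorphism of `H¹`**: for `u ∈ GL(H¹(X; R))` (`H•(X) = ⋀•H¹`), the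
automorphism `⋀ᵈu` of `Hᵈ(X; R)` with inverse `⋀ᵈu⁻¹` — the action `γ ↦ ⋀•γ` of `GL(V(A))` on
`H•(A) = ⋀•V(A)^∨` through which Milne's `L(A) ≤ GL(V(A)) × 𝔾_m` acts on the cohomology of `A`.
A `def` with a body. [cite: Milne1999LefschetzClasses, §4 p. 659 (Def. 4.3)] [cite: HatcherAT2002, §3.2 Example 3.16] -/
def exteriorPullbackEquiv (hX : HasExteriorCohomologyH1 R X)
    (u : singularCohomology R R X 1 ≃ₗ[R] singularCohomology R R X 1) (d : ℕ) :
    singularCohomology R R X d ≃ₗ[R] singularCohomology R R X d :=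
  LinearEquiv.ofLinear (exteriorPullback hX u.toLinearMap d) (exteriorPullback hX u.symm.toLinearMap d)
    (by rw [← exteriorPullback_comp hX hX, ← LinearEquiv.coe_trans, LinearEquiv.symm_trans_self,
      LinearEquiv.refl_toLinearMap, exteriorPullback_id])
    (by rw [← exteriorPullback_comp hX hX, ← LinearEquiv.coe_trans, LinearEquiv.self_trans_symm,
      LinearEquiv.refl_toLinearMap, exteriorPullback_id])

/-- `⋀ᵈu` acts by the exterior pull-back of `u`. [cite: HatcherAT2002, §3.2 Example 3.16] -/
@[simp] theorem exteriorPullbackEquiv_apply (hX : HasExteriorCohomologyH1 R X)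
    (u : singularCohomology R R X 1 ≃ₗ[R] singularCohomology R R X 1) (d : ℕ) (x : singularCohomology R R X d) :
    exteriorPullbackEquiv hX u d x = exteriorPullback hX u.toLinearMap d x := rfl

/-- `(⋀ᵈu : Hᵈ → Hᵈ) = ⋀ᵈu` as linear maps. [cite: HatcherAT2002, §3.2 Example 3.16] -/
theorem coe_exteriorPullbackEquiv (hX : HasExteriorCohomologyH1 R X)
    (u : singularCohomology R R X 1 ≃ₗ[R] singularCohomology R R X 1) (d : ℕ) :
    (exteriorPullbackEquiv hX u d : singularCohomology R R X d →ₗ[R] singularCohomology R R X d) =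
      exteriorPullback hX u.toLinearMap d := rfl

/-- `⋀¹u = u`. [cite: HatcherAT2002, §3.2 Example 3.16] -/
theorem exteriorPullbackEquiv_one_eq (hX : HasExteriorCohomologyH1 R X)
    (u : singularCohomology R R X 1 ≃ₗ[R] singularCohomology R R X 1) : exteriorPullbackEquiv hX u 1 = u := by
  refine LinearEquiv.toLinearMap_injective (exteriorPullback_ext hX fun v ↦ ?_)
  rw [coe_exteriorPullbackEquiv, exteriorPullback_cupPowOne, cupPowOne_one, cupPowOne_one]

end Exterior

/-! ### §2 The Künneth step on `B × C`: `⋀•(s ⊕ t)` against cross products -/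

section KunnethStep

variable {B C : AbelianVariety ℂ} (s : complexBetti B.X 1 ≃ₗ[ℂ] complexBetti B.X 1)
  (t : complexBetti C.X 1 ≃ₗ[ℂ] complexBetti C.X 1)

/-- `⋀ⁱ(s ⊕ t) ∘ pr_B^* = pr_B^* ∘ ⋀ⁱs` on `Hⁱ(B)`. [cite: Milne1999LefschetzClasses, §1 p. 643 and §4 p. 659]
[cite: HatcherAT2002, §3.2 Prop. 3.10 and Example 3.16] -/
theorem exteriorPullback_prodBlockDiagEquiv_map_fst (i : ℕ) (x : complexBetti B.X i) :
    exteriorPullback (AbelianVariety.hasExteriorCohomologyH1_complexPoints (B.prod C))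
        (prodBlockDiagEquiv s t).toLinearMap i (complexBetti.map (AbelianVariety.fst B C).hom.hom.hom i x) =
      complexBetti.map (AbelianVariety.fst B C).hom.hom.hom i
        (exteriorPullback (AbelianVariety.hasExteriorCohomologyH1_complexPoints B) s.toLinearMap i x) := by
  have hB := AbelianVariety.hasExteriorCohomologyH1_complexPoints B
  have hBC := AbelianVariety.hasExteriorCohomologyH1_complexPoints (B.prod C)
  -- both sides are linear in `x`; compare them on products of degree-one classes
  suffices h : (exteriorPullback hBC (prodBlockDiagEquiv s t).toLinearMap i).comp
      (complexBetti.map (AbelianVariety.fst B C).hom.hom.hom i).hom =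
      (complexBetti.map (AbelianVariety.fst B C).hom.hom.hom i).hom.comp (exteriorPullback hB s.toLinearMap i) from
    LinearMap.congr_fun h x
  refine exteriorPullback_ext hB fun v ↦ ?_
  rw [LinearMap.comp_apply, LinearMap.comp_apply, exteriorPullback_cupPowOne]
  change exteriorPullback hBC _ i (complexBetti.map _ i (cupPowOne ℂ _ i v)) =
    complexBetti.map _ i (cupPowOne ℂ _ i _)
  rw [complexBetti_map_cupPowOne, complexBetti_map_cupPowOne, exteriorPullback_cupPowOne]
  congr 1
  funext l
  exact prodBlockDiagEquiv_apply_map_fst s t (v l)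

/-- `⋀ʲ(s ⊕ t) ∘ pr_C^* = pr_C^* ∘ ⋀ʲt` on `Hʲ(C)`. [cite: Milne1999LefschetzClasses, §1 p. 643 and §4 p. 659]
[cite: HatcherAT2002, §3.2 Prop. 3.10 and Example 3.16] -/
theorem exteriorPullback_prodBlockDiagEquiv_map_snd (j : ℕ) (y : complexBetti C.X j) :
    exteriorPullback (AbelianVariety.hasExteriorCohomologyH1_complexPoints (B.prod C))
        (prodBlockDiagEquiv s t).toLinearMap j (complexBetti.map (AbelianVariety.snd B C).hom.hom.hom j y) =
      complexBetti.map (AbelianVariety.snd B C).hom.hom.hom j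
        (exteriorPullback (AbelianVariety.hasExteriorCohomologyH1_complexPoints C) t.toLinearMap j y) := by
  have hC := AbelianVariety.hasExteriorCohomologyH1_complexPoints C
  have hBC := AbelianVariety.hasExteriorCohomologyH1_complexPoints (B.prod C)
  suffices h : (exteriorPullback hBC (prodBlockDiagEquiv s t).toLinearMap j).comp
      (complexBetti.map (AbelianVariety.snd B C).hom.hom.hom j).hom =
      (complexBetti.map (AbelianVariety.snd B C).hom.hom.hom j).hom.comp (exteriorPullback hC t.toLinearMap j) from
    LinearMap.congr_fun h y
  refine exteriorPullback_ext hC fun v ↦ ?_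
  rw [LinearMap.comp_apply, LinearMap.comp_apply, exteriorPullback_cupPowOne]
  change exteriorPullback hBC _ j (complexBetti.map _ j (cupPowOne ℂ _ j v)) =
    complexBetti.map _ j (cupPowOne ℂ _ j _)
  rw [complexBetti_map_cupPowOne, complexBetti_map_cupPowOne, exteriorPullback_cupPowOne]
  congr 1
  funext l
  exact prodBlockDiagEquiv_apply_map_snd s t (v l)

/-- **The Künneth step**: `⋀ᵏ(s ⊕ t) (pr_B^* x ∪ pr_C^* y) = pr_B^* (⋀ⁱs x) ∪ pr_C^* (⋀ʲt y)` on `B × C`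
(`⋀•(s ⊕ t)` is multiplicative and natural along the two projections) — the compatibility with cross
products that makes `(⋀•u^{⊕(a+1)})_a` a Künneth family in the sense of `HodgeTheory.IsKunnethFamily`.
[cite: Milne1999LefschetzClasses, §4 p. 659 (Def. 4.3: L(A) acting on H(A^r))] [cite: HatcherAT2002, §3.2 Thm. 3.16] -/
theorem exteriorPullback_prodBlockDiagEquiv_cross {i j k : ℕ} (h : i + j = k) (x : complexBetti B.X i)
    (y : complexBetti C.X j) :
    exteriorPullback (AbelianVariety.hasExteriorCohomologyH1_complexPoints (B.prod C))
        (prodBlockDiagEquiv s t).toLinearMap k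
        (cupProduct h (complexBetti.map (AbelianVariety.fst B C).hom.hom.hom i x)
          (complexBetti.map (AbelianVariety.snd B C).hom.hom.hom j y)) =
      cupProduct h
        (complexBetti.map (AbelianVariety.fst B C).hom.hom.hom i
          (exteriorPullback (AbelianVariety.hasExteriorCohomologyH1_complexPoints B) s.toLinearMap i x))
        (complexBetti.map (AbelianVariety.snd B C).hom.hom.hom j
          (exteriorPullback (AbelianVariety.hasExteriorCohomologyH1_complexPoints C) t.toLinearMap j y)) := by
  rw [exteriorPullback_cupProduct, exteriorPullback_prodBlockDiagEquiv_map_fst,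
    exteriorPullback_prodBlockDiagEquiv_map_snd]

end KunnethStep

/-! ### §3 The product polarization class `pr_B^* h_B + pr_C^* h_C`: Hodge span, top power, non-degeneracy -/

section ProductClass

variable {B C : AbelianVariety ℂ} (hB : complexBetti B.X 2) (hC : complexBetti C.X 2)

/-- `f^*(B¹(Q) ⊗ ℂ) ⊆ B¹(P) ⊗ ℂ` for a homomorphism `f : P → Q` of complex abelian varieties (rational
classes pull back to rational classes, `(1,1)`-classes to `(1,1)`-classes). [cite: vanGeemen1994HodgeAV, 2.1]
[cite: VoisinHodgeI2002, §7.3.2] -/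
theorem map_mem_hodgeClassSpan_one {P Q : AbelianVariety ℂ} (f : P ⟶ Q) {c : complexBetti Q.X 2}
    (hc : c ∈ hodgeClassSpan Q.dim Q.X 1) :
    complexBetti.map f.hom.hom.hom 2 c ∈ hodgeClassSpan P.dim P.X 1 := by
  have hP : IsSmoothProjective P.dim P.X := AbelianVariety.isSmoothProjective_holds (A := P)
  have hQ : IsSmoothProjective Q.dim Q.X := AbelianVariety.isSmoothProjective_holds (A := Q)
  induction hc using Submodule.span_induction with
  | mem x hx =>
    exact Submodule.subset_span ⟨hx.1.pullback _, hx.2.map_of_isSmoothProjective hP hQ f.hom.hom.hom⟩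
  | zero => rw [map_zero]; exact zero_mem _
  | add x y _ _ hx hy => rw [map_add]; exact add_mem hx hy
  | smul r x _ hx => rw [map_smul]; exact Submodule.smul_mem _ r hx

/-- `pr_B^* h_B + pr_C^* h_C ∈ B¹(B × C) ⊗ ℂ` when `h_B ∈ B¹(B) ⊗ ℂ`, `h_C ∈ B¹(C) ⊗ ℂ` (Milne §1 p. 643:
`D = D_B × C + B × D_C` is a divisor on `B × C`). [cite: Milne1999LefschetzClasses, §1 p. 643] -/
theorem prodPolarizationClass_mem_hodgeClassSpan (hhB : hB ∈ hodgeClassSpan B.dim B.X 1)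
    (hhC : hC ∈ hodgeClassSpan C.dim C.X 1) :
    prodPolarizationClass B C hB hC ∈ hodgeClassSpan (B.prod C).dim (B.prod C).X 1 :=
  add_mem (map_mem_hodgeClassSpan_one _ hhB) (map_mem_hodgeClassSpan_one _ hhC)

/-- **The top power of the product polarization does not vanish**: if `h_B^{dim B} ≠ 0` and
`h_C^{dim C} ≠ 0` then `(pr_B^* h_B + pr_C^* h_C)^{dim B + dim C} ≠ 0` — it is
`C(dim B + dim C, dim B) · pr_B^* h_B^{dim B} ∪ pr_C^* h_C^{dim C}` (binomial theorem, all other terms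
vanish by degree), a non-zero cross product of top classes (Milne §1 p. 643: "`D` is an ample divisor on
`A`"; here only the non-vanishing of its top self-intersection is recorded).
[cite: Milne1999LefschetzClasses, §1 p. 643] [cite: LangeBirkenhake1992, §5.3] [cite: HatcherAT2002, §3.2 Thm. 3.16] -/
theorem lefschetzPow_prodPolarizationClass_self_ne_zero (hB0 : 0 < B.dim) (hC0 : 0 < C.dim)
    (hBtop : lefschetzPow hB (B.dim - 1) 2 hB ≠ 0) (hCtop : lefschetzPow hC (C.dim - 1) 2 hC ≠ 0) :
    lefschetzPow (prodPolarizationClass B C hB hC) ((B.prod C).dim - 1) 2 (prodPolarizationClass B C hB hC) ≠ 0 := by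
  have hBsp : IsSmoothProjective (B.dim - 1 + 1) B.X := by
    rw [Nat.sub_add_cancel hB0]; exact AbelianVariety.isSmoothProjective_holds (A := B)
  have hCsp : IsSmoothProjective (C.dim - 1 + 1) C.X := by
    rw [Nat.sub_add_cancel hC0]; exact AbelianVariety.isSmoothProjective_holds (A := C)
  have hm : (B.prod C).dim - 1 = (B.dim - 1) + (C.dim - 1) + 1 := prod_dim_sub_one hB0 hC0
  set m := (B.prod C).dim - 1 with hm_def
  set f := (AbelianVariety.fst B C).hom.hom.hom with hf
  set g := (AbelianVariety.snd B C).hom.hom.hom with hg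
  have hdeg : (2 + 2 * (B.dim - 1)) + (2 + 2 * (C.dim - 1)) = 2 + 2 * m := by omega
  -- the surviving cross product `T = pr_B^* h_B^{dim B} ∪ pr_C^* h_C^{dim C} ≠ 0`
  set T := cupProduct hdeg (complexBetti.map f (2 + 2 * (B.dim - 1)) (lefschetzPow hB (B.dim - 1) 2 hB))
    (complexBetti.map g (2 + 2 * (C.dim - 1)) (lefschetzPow hC (C.dim - 1) 2 hC)) with hT
  have hT0 : T ≠ 0 := fun h0 ↦ hBtop
    (eq_zero_of_cupProduct_map_fst_map_snd_eq_zero_left (A := B) (B := C)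
      (show 2 + 2 * (C.dim - 1) = 2 * C.dim by omega)
      (AbelianVariety.isSmoothProjective_holds (A := C)) hdeg hCtop h0)
  -- the two halves `L^m(pr_B^* h_B)` and `L^m(pr_C^* h_C)` of `L^m(h)`, `h = pr_B^* h_B + pr_C^* h_C`
  have e1 : complexBetti.map g 0 (singularCohomology.one ℂ (ComplexPoints C.X)) =
      singularCohomology.one ℂ (ComplexPoints (B.prod C).X) := singularCohomology.map_one _
  have e2 : complexBetti.map f 0 (singularCohomology.one ℂ (ComplexPoints B.X)) =
      singularCohomology.one ℂ (ComplexPoints (B.prod C).X) := singularCohomology.map_one _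
  have H1 : lefschetzPow (prodPolarizationClass B C hB hC) m 2 (complexBetti.map f 2 hB) =
      ((m.choose (B.dim - 1) : ℕ) : ℂ) • T := by
    rw [← cupProduct_one (complexBetti.map f 2 hB), ← e1, prodPolarizationClass_def,
      lefschetzPow_add_map_cupProduct_eq_single f g hBsp hCsp m (Nat.add_zero 2) hB hC hB
        (singularCohomology.one ℂ (ComplexPoints C.X)) (B.dim - 1) (C.dim - 1 + 1) (by omega) (by omega)
        (by omega),
      lefschetzPow_succ_one_eq_degCast, map_degCast, cupProduct_degCast_right]
  have H2 : lefschetzPow (prodPolarizationClass B C hB hC) m 2 (complexBetti.map g 2 hC) =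
      ((m.choose (B.dim - 1 + 1) : ℕ) : ℂ) • T := by
    rw [← one_cupProduct (complexBetti.map g 2 hC), ← e2, prodPolarizationClass_def,
      lefschetzPow_add_map_cupProduct_eq_single f g hBsp hCsp m (Nat.zero_add 2) hB hC
        (singularCohomology.one ℂ (ComplexPoints B.X)) hC (B.dim - 1 + 1) (C.dim - 1) (by omega) (by omega)
        (by omega),
      lefschetzPow_succ_one_eq_degCast, map_degCast, cupProduct_degCast_left]
  have hsum : lefschetzPow (prodPolarizationClass B C hB hC) m 2 (prodPolarizationClass B C hB hC) =
      (((m + 1).choose (B.dim - 1 + 1) : ℕ) : ℂ) • T := by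
    have hsplit : lefschetzPow (prodPolarizationClass B C hB hC) m 2 (prodPolarizationClass B C hB hC) =
        lefschetzPow (prodPolarizationClass B C hB hC) m 2 (complexBetti.map f 2 hB) +
          lefschetzPow (prodPolarizationClass B C hB hC) m 2 (complexBetti.map g 2 hC) := by
      rw [← map_add]
      rfl
    rw [hsplit, H1, H2, ← add_smul, ← Nat.cast_add, Nat.choose_succ_succ']
  rw [hsum, smul_ne_zero_iff]
  refine ⟨Nat.cast_ne_zero.2 (Nat.pos_iff_ne_zero.1 (Nat.choose_pos (by omega))), hT0⟩

/-- **Non-degeneracy of `Q_D` on `B × C` from the factors** (block form of `Q_D`, Milne §1 p. 643: the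
involution of `D = D_B × C + B × D_C` "is the restriction of the product of the involutions" — in
particular it is again a non-degenerate form): if `Q_{h_B}`, `Q_{h_C}` are non-degenerate on `H¹(B)`,
`H¹(C)` and `h_B^{dim B} ≠ 0 ≠ h_C^{dim C}`, then `Q_{pr_B^* h_B + pr_C^* h_C}` is non-degenerate on
`H¹(B × C) = pr_B^* H¹(B) ⊕ pr_C^* H¹(C)`. [cite: Milne1999LefschetzClasses, §1 p. 643] [cite: LangeBirkenhake1992, §5.3] -/
theorem eq_zero_of_forall_polarizationPairingOne_prod_eq_zero (hB0 : 0 < B.dim) (hC0 : 0 < C.dim)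
    (hBtop : lefschetzPow hB (B.dim - 1) 2 hB ≠ 0) (hCtop : lefschetzPow hC (C.dim - 1) 2 hC ≠ 0)
    (hndB : ∀ x : complexBetti B.X 1, (∀ y, polarizationPairingOne B.X hB (B.dim - 1) x y = 0) → x = 0)
    (hndC : ∀ x : complexBetti C.X 1, (∀ y, polarizationPairingOne C.X hC (C.dim - 1) x y = 0) → x = 0)
    (x : complexBetti (B.prod C).X 1)
    (hx : ∀ y, polarizationPairingOne (B.prod C).X (prodPolarizationClass B C hB hC) ((B.prod C).dim - 1) x y = 0) :
    x = 0 := by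
  have hm : (B.prod C).dim - 1 = (B.dim - 1) + (C.dim - 1) + 1 := prod_dim_sub_one hB0 hC0
  have hC1 : ((((B.prod C).dim - 1).choose (B.dim - 1) : ℕ) : ℂ) ≠ 0 :=
    Nat.cast_ne_zero.2 (Nat.pos_iff_ne_zero.1 (Nat.choose_pos (by omega)))
  have hC2 : ((((B.prod C).dim - 1).choose (B.dim - 1 + 1) : ℕ) : ℂ) ≠ 0 :=
    Nat.cast_ne_zero.2 (Nat.pos_iff_ne_zero.1 (Nat.choose_pos (by omega)))
  set xB := complexBetti.map (AbelianVariety.prodLift (𝟙 B) (0 : B ⟶ C)).hom.hom.hom 1 x with hxB_def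
  set xC := complexBetti.map (AbelianVariety.prodLift (0 : C ⟶ B) (𝟙 C)).hom.hom.hom 1 x with hxC_def
  have ex : x = complexBetti.map (AbelianVariety.fst B C).hom.hom.hom 1 xB +
      complexBetti.map (AbelianVariety.snd B C).hom.hom.hom 1 xC := eq_map_fst_add_map_snd_one x
  -- the `B`-component vanishes: test against `pr_B^* b`
  have hxB : xB = 0 := hndB xB fun b ↦ by
    have e := hx (complexBetti.map (AbelianVariety.fst B C).hom.hom.hom 1 b +
      complexBetti.map (AbelianVariety.snd B C).hom.hom.hom 1 0)
    rw [ex, polarizationPairingOne_prod_add_add hB hC hB0 hC0] at e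
    simp only [map_zero, smul_zero, add_zero] at e
    rw [smul_eq_zero] at e
    exact eq_zero_of_cupProduct_map_fst_map_snd_eq_zero_left (A := B) (B := C)
      (show 2 + 2 * (C.dim - 1) = 2 * C.dim by omega) (AbelianVariety.isSmoothProjective_holds (A := C))
      (prod_topDeg_eq hB0 hC0) hCtop (e.resolve_left hC1)
  -- the `C`-component vanishes: test against `pr_C^* c`
  have hxC : xC = 0 := hndC xC fun c ↦ by
    have e := hx (complexBetti.map (AbelianVariety.fst B C).hom.hom.hom 1 0 +
      complexBetti.map (AbelianVariety.snd B C).hom.hom.hom 1 c)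
    rw [ex, polarizationPairingOne_prod_add_add hB hC hB0 hC0] at e
    simp only [map_zero, LinearMap.zero_apply, smul_zero, zero_add] at e
    rw [smul_eq_zero] at e
    exact eq_zero_of_cupProduct_map_fst_map_snd_eq_zero_right (A := B) (B := C)
      (show 2 + 2 * (C.dim - 1) = 2 * C.dim by omega) (AbelianVariety.isSmoothProjective_holds (A := C))
      (prod_topDeg_eq hB0 hC0) hBtop (e.resolve_left hC2)
  rw [ex, hxB, hxC, map_zero, map_zero, add_zero]

end ProductClass

/-! ### §4 The powers `A^{a+1}`: Hodge span, top power and non-degeneracy of `Σᵢ prᵢ^* h` -/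

section Powers

variable {A : AbelianVariety ℂ} {h : complexBetti A.X 2}

/-- `Σᵢ prᵢ^* h ∈ B¹(A^{a+1}) ⊗ ℂ` for `h ∈ B¹(A) ⊗ ℂ`. [cite: Milne1999LefschetzClasses, §1 p. 643] -/
theorem powPolarizationClass_mem_hodgeClassSpan (hh : h ∈ hodgeClassSpan A.dim A.X 1) :
    ∀ a : ℕ, powPolarizationClass A h a ∈ hodgeClassSpan (A.powSucc a).dim (A.powSucc a).X 1
  | 0 => hh
  | a + 1 => prodPolarizationClass_mem_hodgeClassSpan _ _ (powPolarizationClass_mem_hodgeClassSpan hh a) hh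

/-- `(Σᵢ prᵢ^* h)^{dim A^{a+1}} ≠ 0` as soon as `h^{dim A} ≠ 0` (`0 < dim A`). [cite: Milne1999LefschetzClasses, §1 p. 643]
[cite: LangeBirkenhake1992, §5.3] -/
theorem lefschetzPow_powPolarizationClass_self_ne_zero (hA0 : 0 < A.dim)
    (htop : lefschetzPow h (A.dim - 1) 2 h ≠ 0) : ∀ a : ℕ,
    lefschetzPow (powPolarizationClass A h a) ((A.powSucc a).dim - 1) 2 (powPolarizationClass A h a) ≠ 0
  | 0 => htop
  | a + 1 => lefschetzPow_prodPolarizationClass_self_ne_zero _ _ (dim_powSucc_pos hA0 a) hA0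
      (lefschetzPow_powPolarizationClass_self_ne_zero hA0 htop a) htop

/-- **`Q_{Σᵢ prᵢ^* h}` is non-degenerate on `H¹(A^{a+1})`** as soon as `Q_h` is non-degenerate on `H¹(A)`
and `h^{dim A} ≠ 0` (`0 < dim A`) — by induction on the power through the block form of `Q_D` on
`A^{a+2} = A^{a+1} × A` (Milne §1 p. 643). [cite: Milne1999LefschetzClasses, §1 p. 643] [cite: LangeBirkenhake1992, §5.3] -/
theorem eq_zero_of_forall_polarizationPairingOne_powPolarizationClass_eq_zero (hA0 : 0 < A.dim)
    (htop : lefschetzPow h (A.dim - 1) 2 h ≠ 0)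
    (hnd : ∀ x : complexBetti A.X 1, (∀ y, polarizationPairingOne A.X h (A.dim - 1) x y = 0) → x = 0) :
    ∀ (a : ℕ) (x : complexBetti (A.powSucc a).X 1),
      (∀ y, polarizationPairingOne (A.powSucc a).X (powPolarizationClass A h a) ((A.powSucc a).dim - 1) x y = 0) →
        x = 0
  | 0 => hnd
  | a + 1 => eq_zero_of_forall_polarizationPairingOne_prod_eq_zero _ _ (dim_powSucc_pos hA0 a) hA0
      (lefschetzPow_powPolarizationClass_self_ne_zero hA0 htop a) htop
      (eq_zero_of_forall_polarizationPairingOne_powPolarizationClass_eq_zero hA0 htop hnd a) hnd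

end Powers

/-! ### §5 The Künneth family `(⋀•u^{⊕(a+1)})_a` on the powers `A^{a+1}` and what it fixes -/

section Family

variable (A : AbelianVariety ℂ) (u : complexBetti A.X 1 ≃ₗ[ℂ] complexBetti A.X 1)

/-- **`⋀ᵏ(u^{⊕(a+1)})` on `Hᵏ(A^{a+1}(ℂ); ℂ) = ⋀ᵏ H¹(A^{a+1})`** — the action of `γ = u ∈ GL(V(A))` on the
cohomology of the power `A^{a+1}` (diagonally on `V(A^{a+1}) = (a+1) V(A)`, then on the exterior
algebra). A `def` with a body. [cite: Milne1999LefschetzClasses, §1 p. 643 and §4 p. 659 (Def. 4.3)] -/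
def diagPowExterior (a k : ℕ) : complexBetti (A.powSucc a).X k ≃ₗ[ℂ] complexBetti (A.powSucc a).X k :=
  exteriorPullbackEquiv (AbelianVariety.hasExteriorCohomologyH1_complexPoints (A.powSucc a)) (diagPow A u a) k

variable {A u}

/-- On the first power, `⋀ᵏ(u^{⊕1}) = ⋀ᵏu`. [cite: Milne1999LefschetzClasses, §4 p. 659] -/
theorem diagPowExterior_zero (k : ℕ) :
    diagPowExterior A u 0 k = exteriorPullbackEquiv (AbelianVariety.hasExteriorCohomologyH1_complexPoints A) u k :=
  rfl

/-- The projections of `A^{a+2} = A^{a+1} × A` are the cartesian projections of the underlying schemes. [folklore] -/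
private theorem fst_hom_eq (B C : AbelianVariety ℂ) : (AbelianVariety.fst B C).hom.hom.hom = fst B.X C.X := rfl

/-- The projections of `A^{a+2} = A^{a+1} × A` are the cartesian projections of the underlying schemes. [folklore] -/
private theorem snd_hom_eq (B C : AbelianVariety ℂ) : (AbelianVariety.snd B C).hom.hom.hom = snd B.X C.X := rfl

/-- **The Künneth property of `(⋀•u^{⊕(a+1)})_a` on the powers**: on `A^{a+2} = A^{a+1} × A`,
`⋀ᵏ(u^{⊕(a+2)}) (pr₁^* x ∪ pr₂^* y) = pr₁^* (⋀ⁱ(u^{⊕(a+1)}) x) ∪ pr₂^* (⋀ʲu y)`.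
[cite: Milne1999LefschetzClasses, §4 p. 659 (Def. 4.3)] [cite: HatcherAT2002, §3.2 Thm. 3.16] -/
theorem diagPowExterior_cross (a : ℕ) {i j k : ℕ} (hk : i + j = k) (x : complexBetti (A.powSucc a).X i)
    (y : complexBetti A.X j) :
    diagPowExterior A u (a + 1) k
        (cupProduct hk (complexBetti.map (fst (A.powSucc a).X A.X) i x) (complexBetti.map (snd (A.powSucc a).X A.X) j y)) =
      cupProduct hk (complexBetti.map (fst (A.powSucc a).X A.X) i (diagPowExterior A u a i x))
        (complexBetti.map (snd (A.powSucc a).X A.X) j (diagPowExterior A u 0 j y)) := by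
  rw [← fst_hom_eq, ← snd_hom_eq]
  exact exteriorPullback_prodBlockDiagEquiv_cross (diagPow A u a) u hk x y

variable {h : complexBetti A.X 2}

/-- **`⋀•(u^{⊕(a+1)})` fixes every divisor class of every power**: for `0 < dim A`, `h ∈ B¹(A) ⊗ ℂ` with
`h^{dim A} ≠ 0` and `Q_h` non-degenerate, and `u ∈ S(A)(h)`, the family `⋀^{2p}(u^{⊕(a+1)})` fixes
`D^p_hom(A^{a+1})_ℂ` — Milne's "any `γ ∈ G(A)(k^al)` will fix all divisor classes on `A^r`, all `r`"
(Thm. 4.4, proof), as `u^{⊕(a+1)} ∈ S(A^{a+1})(Σᵢ prᵢ^* h)` (`diagPow_mem_unitaryCentralizerGroup`) and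
`S` fixes divisor classes (`exteriorPullback_eq_self_of_mem_divisorClassesSpan_of_nondegenerate` on `A^{a+1}`).
[cite: Milne1999LefschetzClasses, Thm. 4.4 (proof, p. 659) and §1 pp. 643–644] -/
theorem diagPowExterior_apply_eq_self_of_mem_divisorClassesSpan (hA0 : 0 < A.dim)
    (hh : h ∈ hodgeClassSpan A.dim A.X 1) (htop : lefschetzPow h (A.dim - 1) 2 h ≠ 0)
    (hnd : ∀ x : complexBetti A.X 1, (∀ y, polarizationPairingOne A.X h (A.dim - 1) x y = 0) → x = 0)
    (hu : u ∈ unitaryCentralizerGroup A h) (a p : ℕ) {c : complexBetti (A.powSucc a).X (2 * p)}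
    (hc : c ∈ divisorClassesSpan (A.powSucc a).X (A.powSucc a).dim p) : diagPowExterior A u a (2 * p) c = c :=
  exteriorPullback_eq_self_of_mem_divisorClassesSpan_of_nondegenerate (powPolarizationClass_mem_hodgeClassSpan hh a)
    (eq_zero_of_forall_polarizationPairingOne_powPolarizationClass_eq_zero hA0 htop hnd a)
    (diagPow_mem_unitaryCentralizerGroup hA0 hu a) p hc

end Family

/-! ### §6 Transport to the cartesian powers `A.X^{×(a+1)}` and Theorem 4.4 on `H¹` -/

section Transport

/-- Transport of a family of automorphisms of `H•(Y(ℂ); ℂ)` along an identification `Y = Y'` of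
`ℂ`-schemes (used with `AbelianVariety.powSucc_X_eq_cartesianPow`: the cohomology of the abelian variety
`A^{a+1}` as the cohomology of the cartesian power `A.X^{×(a+1)}` of `HodgeTheory/MotivatedGaloisGroup`).
A `def` with a body (`Eq.rec`). [folklore] -/
def castAut {Y Y' : Motives.SchemeOver ℂ} (e : Y = Y')
    (G : ∀ k : ℕ, complexBetti Y k ≃ₗ[ℂ] complexBetti Y k) : ∀ k : ℕ, complexBetti Y' k ≃ₗ[ℂ] complexBetti Y' k :=
  e ▸ G

/-- Transport of the Künneth compatibility along `Y = Y'` (the factor `X` fixed). [folklore] -/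
private theorem castAut_cross {Y Y' : Motives.SchemeOver ℂ} (e : Y = Y') (X : Motives.SchemeOver ℂ)
    (GY : ∀ k : ℕ, complexBetti Y k ≃ₗ[ℂ] complexBetti Y k) (G0 : ∀ k : ℕ, complexBetti X k ≃ₗ[ℂ] complexBetti X k)
    (GYX : ∀ k : ℕ, complexBetti (Y ⊗ X) k ≃ₗ[ℂ] complexBetti (Y ⊗ X) k)
    (H : ∀ (i j k : ℕ) (hk : i + j = k) (x : complexBetti Y i) (y : complexBetti X j),
      GYX k (cupProduct hk (complexBetti.map (fst Y X) i x) (complexBetti.map (snd Y X) j y)) =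
        cupProduct hk (complexBetti.map (fst Y X) i (GY i x)) (complexBetti.map (snd Y X) j (G0 j y)))
    {i j k : ℕ} (hk : i + j = k) (x : complexBetti Y' i) (y : complexBetti X j) :
    castAut (congrArg (fun Z ↦ Z ⊗ X) e) GYX k
        (cupProduct hk (complexBetti.map (fst Y' X) i x) (complexBetti.map (snd Y' X) j y)) =
      cupProduct hk (complexBetti.map (fst Y' X) i (castAut e GY i x)) (complexBetti.map (snd Y' X) j (G0 j y)) := by
  subst e
  exact H i j k hk x y

/-- Transport of "fixes every divisor class" along `Y = Y'`, `N = N'`. [folklore] -/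
private theorem castAut_apply_eq_self {Y Y' : Motives.SchemeOver ℂ} (e : Y = Y') {N N' : ℕ} (hN : N = N')
    (G : ∀ k : ℕ, complexBetti Y k ≃ₗ[ℂ] complexBetti Y k)
    (hG : ∀ (p : ℕ), ∀ c ∈ divisorClassesSpan Y N p, G (2 * p) c = c)
    (p : ℕ) (c : complexBetti Y' (2 * p)) (hc : c ∈ divisorClassesSpan Y' N' p) : castAut e G (2 * p) c = c := by
  subst e hN
  exact hG p c hc

variable (A : AbelianVariety ℂ) (u : complexBetti A.X 1 ≃ₗ[ℂ] complexBetti A.X 1)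

/-- **The Künneth family of `u ∈ GL(H¹(A))` on the cartesian powers `A.X^{×(a+1)}`**: `⋀•(u^{⊕(a+1)})`
read on `H•(A.X^{×(a+1)})` (`(A^{a+1}).X = A.X^{×(a+1)}`, `AbelianVariety.powSucc_X_eq_cartesianPow`).
A `def` with a body. [cite: Milne1999LefschetzClasses, §4 p. 659 (Def. 4.3)] -/
def exteriorKunnethFamily (a k : ℕ) :
    complexBetti (cartesianPow A.X (a + 1)) k ≃ₗ[ℂ] complexBetti (cartesianPow A.X (a + 1)) k :=
  castAut (A.powSucc_X_eq_cartesianPow a) (diagPowExterior A u a) k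

/-- On the first power the family is `(⋀ᵏu)_k`. [cite: Milne1999LefschetzClasses, §4 p. 659] -/
theorem exteriorKunnethFamily_zero :
    exteriorKunnethFamily A u 0 =
      fun k ↦ exteriorPullbackEquiv (AbelianVariety.hasExteriorCohomologyH1_complexPoints A) u k :=
  rfl

/-- **`(⋀•u^{⊕(a+1)})_a` is a Künneth family** (`HodgeTheory.IsKunnethFamily`): the diagonal extension of
`(⋀ᵏu)_k` to all powers. [cite: Milne1999LefschetzClasses, §4 p. 659 (Def. 4.3)] [cite: HatcherAT2002, §3.2 Thm. 3.16] -/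
theorem isKunnethFamily_exteriorKunnethFamily : IsKunnethFamily A.X (exteriorKunnethFamily A u) := by
  refine ⟨fun a i j k hk x y ↦ ?_⟩
  exact castAut_cross (A.powSucc_X_eq_cartesianPow a) A.X (diagPowExterior A u a) (exteriorKunnethFamily A u 0)
    (diagPowExterior A u (a + 1)) (fun i j k hk x y ↦ diagPowExterior_cross a hk x y) hk x y

variable {A u} {h : complexBetti A.X 2}

/-- The Künneth family of `u ∈ S(A)(h)` fixes every Lefschetz class of every power (`0 < dim A`,
`h ∈ B¹(A) ⊗ ℂ`, `h^{dim A} ≠ 0`, `Q_h` non-degenerate). [cite: Milne1999LefschetzClasses, Thm. 4.4 (proof, p. 659)] -/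
theorem exteriorKunnethFamily_apply_eq_self_of_mem_lefschetzPowClasses (hA0 : 0 < A.dim)
    (hh : h ∈ hodgeClassSpan A.dim A.X 1) (htop : lefschetzPow h (A.dim - 1) 2 h ≠ 0)
    (hnd : ∀ x : complexBetti A.X 1, (∀ y, polarizationPairingOne A.X h (A.dim - 1) x y = 0) → x = 0)
    (hu : u ∈ unitaryCentralizerGroup A h) (a p : ℕ) {c : complexBetti (cartesianPow A.X (a + 1)) (2 * p)}
    (hc : c ∈ lefschetzPowClasses A.dim A.X a p) : exteriorKunnethFamily A u a (2 * p) c = c :=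
  castAut_apply_eq_self (A.powSucc_X_eq_cartesianPow a) (A.dim_powSucc_eq_cartesianPowDim a)
    (diagPowExterior A u a)
    (fun p _ hc ↦ diagPowExterior_apply_eq_self_of_mem_divisorClassesSpan hA0 hh htop hnd hu a p hc) p c hc

/-- **`S(A)(h) ≤ {g₁ | g ∈ ker l(A)}` under the hypotheses the proof uses**: for `0 < dim A`,
`h ∈ B¹(A) ⊗ ℂ` with `h^{dim A} ≠ 0` and `Q_h` non-degenerate, every `u ∈ unitaryCentralizerGroup A h` is
the degree-one component of the element `(⋀ᵏu)_k` of `specialLefschetzGroup (dim A) A.X` (its Künneth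
family `⋀•(u^{⊕(a+1)})` fixes all Lefschetz classes on all powers). [cite: Milne1999LefschetzClasses, Thm. 4.4 (proof, p. 659)] -/
theorem exteriorPullbackEquiv_mem_specialLefschetzGroup (hA0 : 0 < A.dim)
    (hh : h ∈ hodgeClassSpan A.dim A.X 1) (htop : lefschetzPow h (A.dim - 1) 2 h ≠ 0)
    (hnd : ∀ x : complexBetti A.X 1, (∀ y, polarizationPairingOne A.X h (A.dim - 1) x y = 0) → x = 0)
    (hu : u ∈ unitaryCentralizerGroup A h) :
    (fun k ↦ exteriorPullbackEquiv (AbelianVariety.hasExteriorCohomologyH1_complexPoints A) u k) ∈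
      specialLefschetzGroup A.dim A.X :=
  ⟨exteriorKunnethFamily A u, isKunnethFamily_exteriorKunnethFamily A u, exteriorKunnethFamily_zero A u,
    fun a p _ hc ↦ exteriorKunnethFamily_apply_eq_self_of_mem_lefschetzPowClasses hA0 hh htop hnd hu a p hc⟩

end Transport

/-! ### §7 The record `Milne1999_thm44_specialLefschetzGroup_one_eq_unitaryCentralizerGroup`, discharged -/

section Main

variable {A : AbelianVariety ℂ} {h : complexBetti A.X 2}

/-- A rational class with a Kähler multiple `s · h`, `s ≠ 0`, lies in `B¹(A) ⊗ ℂ` (Kähler classes are of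
type `(1,1)`). [cite: VoisinHodgeI2002, §7.1.2] -/
theorem mem_hodgeClassSpan_one_of_isKaehlerClass_smul (hQ : IsRationalClass h) {s : ℝ} (hs : s ≠ 0)
    (hK : IsKaehlerClass A.dim A.X ((s : ℂ) • h)) : h ∈ hodgeClassSpan A.dim A.X 1 := by
  have h11 : IsOfHodgeType A.dim A.X 2 1 1 h := by
    have e := (hK.isOfHodgeType_one_one).smul ((s : ℂ)⁻¹)
    rwa [smul_smul, inv_mul_cancel₀ (Complex.ofReal_ne_zero.2 hs), one_smul] at e
  exact Submodule.subset_span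
    (show h ∈ {c : complexBetti A.X (2 * 1) | IsRationalClass c ∧ IsOfHodgeType A.dim A.X (2 * 1) 1 1 c}
      from ⟨hQ, h11⟩)

/-- `h^{dim A} ≠ 0` in the spelling `L^{dim A - 1}_h h ≠ 0`, for `h` with a Kähler multiple `s · h`, `s ≠ 0`
(`0 < dim A`; Voisin I Cor. 3.9: the powers of a Kähler class do not vanish). [cite: VoisinHodgeI2002, §3.1.3 Cor. 3.9] -/
theorem lefschetzPow_self_ne_zero_of_isKaehlerClass_smul (hA0 : 0 < A.dim) {s : ℝ}
    (hK : IsKaehlerClass A.dim A.X ((s : ℂ) • h)) : lefschetzPow h (A.dim - 1) 2 h ≠ 0 := by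
  have hX : IsSmoothProjective A.dim A.X := AbelianVariety.isSmoothProjective_holds (A := A)
  have hpow : ∀ m, m = A.dim → cupPowTwo h m ≠ 0 := by
    rintro m rfl h0
    have e := hK.cupPowTwo_ne_zero hX (p := A.dim) hA0 le_rfl
    rw [cupPowTwo_smul, h0, smul_zero] at e
    exact e rfl
  rw [HodgeRiemannDegreeOne.lefschetzPow_self_eq_cupPowTwo]
  exact HodgeRiemannDegreeOne.cupProduct_ne_zero_of_degree_eq (two_mul_add_two (A.dim - 1)) _
    (hpow (A.dim - 1 + 1) (Nat.sub_add_cancel hA0))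

/-- `Q_h` is non-degenerate on `H¹(A(ℂ); ℂ)` for `h` with a Kähler multiple `s · h`, `s ≠ 0` (hard Lefschetz,
Voisin I Thm. 6.25, and Poincaré duality; in dimension `0` the group `H¹` vanishes).
[cite: VoisinHodgeI2002, Thm. 6.25] [cite: HatcherAT2002, §3.3 Prop. 3.38] -/
theorem eq_zero_of_forall_polarizationPairingOne_eq_zero_of_isKaehlerClass_smul' {s : ℝ} (hs : s ≠ 0)
    (hK : IsKaehlerClass A.dim A.X ((s : ℂ) • h)) (x : complexBetti A.X 1)
    (hx : ∀ y, polarizationPairingOne A.X h (A.dim - 1) x y = 0) : x = 0 := by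
  rcases Nat.eq_zero_or_pos A.dim with hA | hn
  · haveI : Module.Finite ℂ (complexBetti A.X 1) := abelianVarietyCohomologyExteriorH1_holds.finite_one A
    have hV : Module.finrank ℂ (complexBetti A.X 1) = 0 := by
      rw [AbelianVariety.finrank_complexBetti_one, hA, mul_zero]
    haveI : Subsingleton (complexBetti A.X 1) := Module.finrank_zero_iff.1 hV
    exact Subsingleton.elim _ _
  · have hX : IsSmoothProjective A.dim A.X := AbelianVariety.isSmoothProjective_holds (A := A)
    have hHL : HasHardLefschetzProperty h A.dim := by
      have h1 := HasHardLefschetzProperty.smul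
        (hK.hasHardLefschetzProperty hX fun _ ↦ Motives.hasHardLefschetzProperty_kaehlerClass_holds)
        (inv_ne_zero (Complex.ofReal_ne_zero.2 hs))
      rwa [smul_smul, inv_mul_cancel₀ (Complex.ofReal_ne_zero.2 hs), one_smul] at h1
    exact eq_zero_of_forall_polarizationPairingOne_eq_zero_of_hasHardLefschetzProperty hn hHL hx

/-- **`S(A)(ℂ) ≤ {g₁ | g ∈ ker l(A)(ℂ)}`** — the `⊇` half of Milne's Theorem 4.4 read on `H¹`, for a
polarization class in the record's spelling (`h` rational with `s · h` Kähler, `s > 0`): every element of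
`unitaryCentralizerGroup A h` is the degree-one component of an element of `specialLefschetzGroup (dim A) A.X`
("any `γ ∈ G(A)(k^al)` will fix all divisor classes on `A^r`, all `r`. This shows that `G(A) ⊂ L(A)`").
[cite: Milne1999LefschetzClasses, Thm. 4.4 (proof, p. 659)] -/
theorem unitaryCentralizerGroup_le_specialLefschetzGroup_map_one (hQ : IsRationalClass h)
    (hK : ∃ s : ℝ, 0 < s ∧ IsKaehlerClass A.dim A.X ((s : ℂ) • h)) :
    unitaryCentralizerGroup A h ≤ (specialLefschetzGroup A.dim A.X).map
      (Pi.evalMonoidHom (fun k : ℕ ↦ complexBetti A.X k ≃ₗ[ℂ] complexBetti A.X k) 1) := by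
  intro u hu
  obtain ⟨s, hs, hKs⟩ := hK
  rcases Nat.eq_zero_or_pos A.dim with hA | hA0
  · haveI : Module.Finite ℂ (complexBetti A.X 1) := abelianVarietyCohomologyExteriorH1_holds.finite_one A
    have hV : Module.finrank ℂ (complexBetti A.X 1) = 0 := by
      rw [AbelianVariety.finrank_complexBetti_one, hA, mul_zero]
    haveI : Subsingleton (complexBetti A.X 1) := Module.finrank_zero_iff.1 hV
    have hu1 : u = 1 := LinearEquiv.ext fun x ↦ Subsingleton.elim _ _
    rw [hu1]
    exact one_mem _
  · exact Subgroup.mem_map.2 ⟨_, exteriorPullbackEquiv_mem_specialLefschetzGroup hA0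
      (mem_hodgeClassSpan_one_of_isKaehlerClass_smul hQ hs.ne' hKs)
      (lefschetzPow_self_ne_zero_of_isKaehlerClass_smul hA0 hKs)
      (eq_zero_of_forall_polarizationPairingOne_eq_zero_of_isKaehlerClass_smul' hs.ne' hKs) hu,
      exteriorPullbackEquiv_one_eq _ u⟩

/-- **Milne 1999, Theorem 4.4 on `H¹` — the cited record
`Milne1999_thm44_specialLefschetzGroup_one_eq_unitaryCentralizerGroup` DISCHARGED**: for every complex
abelian variety `A` and every polarization class `h` (rational, with `s · h` Kähler for a real `s > 0`),
`{g₁ | g ∈ specialLefschetzGroup (dim A) A.X} = unitaryCentralizerGroup A h = S(A)(ℂ)`. The inclusion `⊆`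
is `specialLefschetzGroup_map_one_le_unitaryCentralizerGroup` (`Milne1999/LefschetzGroupCentraliserInclusion`:
Lefschetz classes of degree `2` on `A × A` force `g₁` to commute with `End(A)` and to preserve `Q_h`); the
inclusion `⊇` is `unitaryCentralizerGroup_le_specialLefschetzGroup_map_one` (this file: the Künneth family
`⋀•(u^{⊕(a+1)})` of `u ∈ S(A)(ℂ)` fixes the divisor classes of every power, by
`Milne1999/CentraliserFixesDivisorClasses` applied to `A^{a+1}` with `u^{⊕(a+1)} ∈ S(A^{a+1})` of
`Milne1999/LefschetzCentraliserPowers` and the blockwise non-degeneracy of `Q_{Σ prᵢ^* h}`).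
[cite: Milne1999LefschetzClasses, Thm. 4.4 and p. 659 (ker l(A) = S(A))] -/
theorem Milne1999_thm44_specialLefschetzGroup_one_eq_unitaryCentralizerGroup_holds :
    Milne1999_thm44_specialLefschetzGroup_one_eq_unitaryCentralizerGroup :=
  fun A _ hQ hK ↦ le_antisymm (specialLefschetzGroup_map_one_le_unitaryCentralizerGroup A hQ hK)
    (unitaryCentralizerGroup_le_specialLefschetzGroup_map_one hQ hK)

/-- **`S(A)(ℂ)` does not depend on the polarization** ("the restriction of `†` to `C(A)` is independent of
the choice of `D`", p. 643), unconditionally: two polarization classes give the same subgroup of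
`GL(H¹(A(ℂ); ℂ))`. [cite: Milne1999LefschetzClasses, §1 pp. 643–644 and Thm. 4.4] -/
theorem unitaryCentralizerGroup_eq_of_isKaehlerClass {h' : complexBetti A.X 2} (hQ : IsRationalClass h)
    (hK : ∃ s : ℝ, 0 < s ∧ IsKaehlerClass A.dim A.X ((s : ℂ) • h)) (hQ' : IsRationalClass h')
    (hK' : ∃ s : ℝ, 0 < s ∧ IsKaehlerClass A.dim A.X ((s : ℂ) • h')) :
    unitaryCentralizerGroup A h = unitaryCentralizerGroup A h' :=
  unitaryCentralizerGroup_eq_of_thm44 Milne1999_thm44_specialLefschetzGroup_one_eq_unitaryCentralizerGroup_holds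
    hQ hK hQ' hK'

/-- **Milne Prop. 4.8 (c) read on `H¹`, unconditionally in the record**: if `Hg′(A) = ker l(A)` (e.g. no
power of `A` supports an exotic Hodge class), then `Hg′(A)(ℂ)|_{H¹} = S(A)(ℂ)`.
[cite: Milne1999LefschetzClasses, Prop. 4.8 (p. 660) and Thm. 4.4] -/
theorem hodgeGroupOne_eq_unitaryCentralizerGroup_of_hodgeGroup_eq (hQ : IsRationalClass h)
    (hK : ∃ s : ℝ, 0 < s ∧ IsKaehlerClass A.dim A.X ((s : ℂ) • h))
    (hc : hodgeGroup A.dim A.X = specialLefschetzGroup A.dim A.X) :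
    hodgeGroupOne A.dim A.X = unitaryCentralizerGroup A h :=
  hodgeGroupOne_eq_unitaryCentralizerGroup_of_thm44
    Milne1999_thm44_specialLefschetzGroup_one_eq_unitaryCentralizerGroup_holds hQ hK hc

/-- **Milne Prop. 4.8, (a) ⇒ `Hg′(A)|_{H¹} = S(A)`, unconditionally in the record**: if no power `A^{a+1}`
supports an exotic Hodge class (`IsDivisorGenerated (A.powSucc a)` for all `a`), then
`Hg′(A)(ℂ)|_{H¹} = S(A)(ℂ)`. [cite: Milne1999LefschetzClasses, Prop. 4.8 (p. 660) and Thm. 4.4] -/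
theorem hodgeGroupOne_eq_unitaryCentralizerGroup_of_forall_isDivisorGenerated' (hQ : IsRationalClass h)
    (hK : ∃ s : ℝ, 0 < s ∧ IsKaehlerClass A.dim A.X ((s : ℂ) • h)) (hA : ∀ a, IsDivisorGenerated (A.powSucc a)) :
    hodgeGroupOne A.dim A.X = unitaryCentralizerGroup A h :=
  hodgeGroupOne_eq_unitaryCentralizerGroup_of_forall_isDivisorGenerated
    Milne1999_thm44_specialLefschetzGroup_one_eq_unitaryCentralizerGroup_holds hQ hK hA

end Main

end Literature.AlgebraicGeometry.Milne1999

end
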